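import Literature.NumberTheory.EllipticCurves.SharpFlatPAdicLFunctionCoeffField
import Literature.NumberTheory.EllipticCurves.PlusMinusPAdicLFunctionProofs
import Summits.BirchSwinnertonDyer.BirchSwinnertonDyer.Theorems.ResidualThetaTransportAtTwoLambdaLowerBoundOEulerFactor
import Mathlib.RingTheory.DiscreteValuationRing.Basic
import HarnessLib

/-!
# The `𝒪`-Pollack pair `(L⁺, L⁻)` of a newform along `ι : K_g → ℚ̄_p` is UNIQUE
# (line «bt26-lambda» of crux (R≥)ᵖ stmt-BirchSwinnertonDyer-26074; lead prover bsd-wall-rtt-p2 g13; `--supports` only)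

HONEST FRAMING. THEOREMS ONLY — no `def`, no named fact, no `sorry`; nothing about any curve or Selmer group is asserted; BSD is
not proved by any of this. For the crux: its analytic exponent `d` is read off `L⁻` of an `𝒪`-Pollack pair `IsPollackPairK g ι Ω L⁺ L⁻`
(Pollack's labelling, `𝒪 = padicCoeffIntegers (range ι)`); `isPollackPairK_unique` proves that the Mazur–Tate congruences DETERMINE the
pair, so `d = λ(L⁻_g)` is an invariant of `(g, ι, Ω)` — the `𝒪`-coefficient twin of the tree's `Sprung2017.IsSprungPair.unique` and the
uniqueness clause of Pollack 2003 Thm. 5.1 / Sprung 2017 Thm. 1.12 over `Λ = 𝒪⟦T⟧`, proved WITHOUT `p`-adic logarithms: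
(1) two solutions of one congruence `θ ≡ P·L (mod ω_n)` in `Λ_𝒪 ⊗ ℚ` differ by `x` with `p^N·P·x ∈ ω_n Λ_𝒪` integrally
(`𝒪⟦T⟧ → ℚ̄_p⟦T⟧` is injective); (2) with `P = ±ω_n^∓`, `ω_n = T ω_n^+ ω_n^-`, cancelling in the domain gives `p^N x ∈ (T ω_n^±)`;
(3) over a DVR, `c·x ∈ (D)` with `c ≠ 0` and `D ≢ 0 (mod 𝔪)` forces `x ∈ (D)` (reduce to the domain `k⟦T⟧`, peel off `ϖ`);
(4) `x ∈ ⋂ₙ (D_n)` with `D_n ≡ T^{d_n} (mod 𝔪)`, `d_n → ∞`, forces `x = 0` (every coefficient is divisible by every `ϖ^K`; `addVal`);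
(5) `T ω_n^±` are monic divisors of `ω_n ≡ T^{pⁿ} (mod p)`, hence `≡ T^{deg}`, with unbounded degrees.
§1 is generic (any DVR), §2 is about `ω_n^±` over any ring of characteristic `p`, §3 specialises to `𝒪 = padicCoeffIntegers S`.

References: [Pollack2003] Thm. 5.1, Prop. 6.18; [Sprung2017] Thm. 1.12; [Washington1997] §7.1.
-/

set_option autoImplicit false
-- D-0017: single-problem summit, so `Summit.BirchSwinnertonDyer.BirchSwinnertonDyer.…` repeats a namespace BY DESIGN.
set_option linter.dupNamespace false

noncomputable section

open scoped Classical

open Polynomial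
open scoped PowerSeries

namespace Summit.BirchSwinnertonDyer.BirchSwinnertonDyer.Theorems.PollackPairK

/-! ## §1. Power series over a discrete valuation ring: cancelling constants, and `⋂ₙ (D_n) = 0` -/

section DVR

variable {O : Type*} [CommRing O] [IsDomain O] [IsDiscreteValuationRing O]

/-- A power series whose reduction modulo `𝔪` vanishes is `ϖ` times a power series (`𝔪 = (ϖ)`). [folklore] -/
theorem exists_eq_C_mul_of_map_residue_eq_zero {ϖ : O} (hϖ : Irreducible ϖ) {y : O⟦X⟧}
    (hy : PowerSeries.map (IsLocalRing.residue O) y = 0) : ∃ y' : O⟦X⟧, y = PowerSeries.C ϖ * y' := by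
  have hcoef : ∀ j, ∃ c : O, PowerSeries.coeff j y = ϖ * c := by
    intro j
    have h1 : IsLocalRing.residue O (PowerSeries.coeff j y) = 0 := by
      rw [← PowerSeries.coeff_map, hy, map_zero]
    rw [IsLocalRing.residue_eq_zero_iff, (IsDiscreteValuationRing.irreducible_iff_uniformizer ϖ).mp hϖ,
      Ideal.mem_span_singleton] at h1
    exact h1
  choose c hc using hcoef
  refine ⟨PowerSeries.mk c, ?_⟩
  ext j
  rw [PowerSeries.coeff_C_mul, PowerSeries.coeff_mk, hc]

/-- **Cancelling one `ϖ`**: if `ϖ·x = D·y` and `D mod 𝔪 ≠ 0`, then `D ∣ x` (`D̄ ȳ = 0` in the domain `k⟦T⟧`). [folklore] -/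
theorem exists_eq_mul_of_C_mul_eq_mul {ϖ : O} (hϖ : Irreducible ϖ) {x y D : O⟦X⟧}
    (hD : PowerSeries.map (IsLocalRing.residue O) D ≠ 0) (h : PowerSeries.C ϖ * x = D * y) :
    ∃ y' : O⟦X⟧, x = D * y' := by
  have hred : PowerSeries.map (IsLocalRing.residue O) D * PowerSeries.map (IsLocalRing.residue O) y = 0 := by
    have hϖ0 : IsLocalRing.residue O ϖ = 0 := by
      rw [IsLocalRing.residue_eq_zero_iff, (IsDiscreteValuationRing.irreducible_iff_uniformizer ϖ).mp hϖ]
      exact Ideal.mem_span_singleton_self ϖ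
    rw [← map_mul, ← h, map_mul, PowerSeries.map_C, hϖ0, map_zero, zero_mul]
  obtain ⟨y', rfl⟩ := exists_eq_C_mul_of_map_residue_eq_zero hϖ ((mul_eq_zero.mp hred).resolve_left hD)
  refine ⟨y', ?_⟩
  have h2 : PowerSeries.C ϖ * x = PowerSeries.C ϖ * (D * y') := by rw [h]; ring
  exact mul_left_cancel₀ ((map_ne_zero_iff _ PowerSeries.C_injective).mpr hϖ.ne_zero) h2

/-- **Cancelling `ϖ^N`.** [folklore] -/
theorem exists_eq_mul_of_C_pow_mul_eq_mul {ϖ : O} (hϖ : Irreducible ϖ) {D : O⟦X⟧}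
    (hD : PowerSeries.map (IsLocalRing.residue O) D ≠ 0) (N : ℕ) :
    ∀ {x y : O⟦X⟧}, PowerSeries.C (ϖ ^ N) * x = D * y → ∃ y' : O⟦X⟧, x = D * y' := by
  induction N with
  | zero =>
    intro x y h
    exact ⟨y, by rwa [pow_zero, map_one, one_mul] at h⟩
  | succ N ih =>
    intro x y h
    have h1 : PowerSeries.C ϖ * (PowerSeries.C (ϖ ^ N) * x) = D * y := by
      rw [← mul_assoc, ← map_mul, ← pow_succ', h]
    obtain ⟨y₁, hy₁⟩ := exists_eq_mul_of_C_mul_eq_mul hϖ hD h1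
    exact ih hy₁

/-- **Cancelling a non-zero constant**: `c·x ∈ (D)`, `c ≠ 0`, `D mod 𝔪 ≠ 0 ⇒ x ∈ (D)` (`c = u·ϖ^N`). [folklore] -/
theorem exists_eq_mul_of_C_mul_eq_mul_of_ne_zero {c : O} (hc : c ≠ 0) {x y D : O⟦X⟧}
    (hD : PowerSeries.map (IsLocalRing.residue O) D ≠ 0) (h : PowerSeries.C c * x = D * y) :
    ∃ y' : O⟦X⟧, x = D * y' := by
  obtain ⟨ϖ, hϖ⟩ := IsDiscreteValuationRing.exists_irreducible O
  obtain ⟨N, u, rfl⟩ := IsDiscreteValuationRing.eq_unit_mul_pow_irreducible hc hϖ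
  have h1 : PowerSeries.C (ϖ ^ N) * x = D * (PowerSeries.C (↑u⁻¹ : O) * y) := by
    have h2 : PowerSeries.C (↑u⁻¹ : O) * (PowerSeries.C ((u : O) * ϖ ^ N) * x) =
        PowerSeries.C (↑u⁻¹ : O) * (D * y) := by rw [h]
    rw [← mul_assoc, ← map_mul, ← mul_assoc, Units.inv_mul, one_mul] at h2
    rw [h2]; ring
  exact exists_eq_mul_of_C_pow_mul_eq_mul hϖ hD N h1

/-- If `D ∣ x` for a family `D_i` with `D_i ≡ T^{d_i} (mod 𝔪)` and `d_i` unbounded, then every coefficient of `x` is divisible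
by every power of a uniformiser. [folklore] -/
theorem pow_dvd_coeff_of_forall_dvd {ϖ : O} (hϖ : Irreducible ϖ) {ι : Type*} (D : ι → O⟦X⟧) (d : ι → ℕ)
    (hD : ∀ i, PowerSeries.map (IsLocalRing.residue O) (D i) = PowerSeries.X ^ (d i))
    (hd : ∀ m : ℕ, ∃ i, m < d i) (K : ℕ) :
    ∀ (x : O⟦X⟧), (∀ i, D i ∣ x) → ∀ j, ϖ ^ K ∣ PowerSeries.coeff j x := by
  induction K with
  | zero => intro x _ j; exact ⟨PowerSeries.coeff j x, by rw [pow_zero, one_mul]⟩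
  | succ K ih =>
    intro x hx j
    have hred : PowerSeries.map (IsLocalRing.residue O) x = 0 := by
      ext m
      obtain ⟨i, hi⟩ := hd m
      obtain ⟨y, hy⟩ := hx i
      rw [hy, map_mul, hD i, PowerSeries.coeff_X_pow_mul', if_neg (not_le.mpr hi), map_zero]
    obtain ⟨x₁, rfl⟩ := exists_eq_C_mul_of_map_residue_eq_zero hϖ hred
    have hx₁ : ∀ i, D i ∣ x₁ := by
      intro i
      obtain ⟨y, hy⟩ := hx i
      have hDi : PowerSeries.map (IsLocalRing.residue O) (D i) ≠ 0 := by
        rw [hD i]; exact pow_ne_zero _ PowerSeries.X_ne_zero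
      obtain ⟨y', hy'⟩ := exists_eq_mul_of_C_mul_eq_mul hϖ hDi hy
      exact ⟨y', hy'⟩
    obtain ⟨c, hc⟩ := ih x₁ hx₁ j
    refine ⟨c, ?_⟩
    rw [PowerSeries.coeff_C_mul, hc, pow_succ]; ring

/-- **`⋂ᵢ (D_i) = 0`** for a family `D_i ≡ T^{d_i} (mod 𝔪)` with `d_i` unbounded. [folklore] -/
theorem eq_zero_of_forall_dvd_of_map_eq_X_pow {ι : Type*} (D : ι → O⟦X⟧) (d : ι → ℕ)
    (hD : ∀ i, PowerSeries.map (IsLocalRing.residue O) (D i) = PowerSeries.X ^ (d i))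
    (hd : ∀ m : ℕ, ∃ i, m < d i) {x : O⟦X⟧} (hx : ∀ i, D i ∣ x) : x = 0 := by
  obtain ⟨ϖ, hϖ⟩ := IsDiscreteValuationRing.exists_irreducible O
  ext j
  rw [map_zero, ← IsDiscreteValuationRing.addVal_eq_top_iff, ENat.eq_top_iff_forall_ge]
  intro K
  have h := (IsDiscreteValuationRing.addVal_le_iff_dvd).mpr (pow_dvd_coeff_of_forall_dvd hϖ D d hD hd K x hx j)
  rwa [IsDiscreteValuationRing.addVal_pow, IsDiscreteValuationRing.addVal_uniformizer hϖ, nsmul_one] at h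

end DVR

/-! ## §2. `ω_n ≡ T^{pⁿ}` and its monic divisors `T·ω_n^±` reduce to powers of `T`; their degrees are unbounded -/

section Cyclotomic

open Literature.NumberTheory.EllipticCurves

variable (p : ℕ) [hp : Fact p.Prime]

/-- `ω_n = (1+T)^{pⁿ} − 1 ≡ T^{pⁿ}` in characteristic `p`. [folklore] -/
theorem map_cyclotomicOmega_eq_X_pow (R : Type*) [CommRing R] [CharP R p] (n : ℕ) :
    (cyclotomicOmega p n).map (Int.castRingHom R) = X ^ (p ^ n) := by
  haveI := Fact.out (p := p.Prime)
  rw [cyclotomicOmega, Polynomial.map_sub, Polynomial.map_pow, Polynomial.map_add, Polynomial.map_X,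
    Polynomial.map_one, add_pow_char_pow, one_pow, add_sub_cancel_right]

/-- A MONIC divisor `D` of `ω_n` in `ℤ[T]` reduces to `T^{deg D}` over any field of characteristic `p`
(`T` is prime in `k[T]`). [folklore] -/
theorem map_eq_X_pow_natDegree_of_dvd_cyclotomicOmega (k : Type*) [Field k] [CharP k p] {D : ℤ[X]}
    (hD : D.Monic) {n : ℕ} (hdvd : D ∣ cyclotomicOmega p n) :
    D.map (Int.castRingHom k) = X ^ D.natDegree := by
  have h1 : D.map (Int.castRingHom k) ∣ X ^ (p ^ n) := by
    rw [← map_cyclotomicOmega_eq_X_pow p k n]; exact Polynomial.map_dvd _ hdvd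
  obtain ⟨i, -, hassoc⟩ := (dvd_prime_pow Polynomial.prime_X _).mp h1
  have heq : D.map (Int.castRingHom k) = X ^ i :=
    Polynomial.eq_of_monic_of_associated (hD.map _) (Polynomial.monic_X_pow i) hassoc
  rw [heq, ← hD.natDegree_map (Int.castRingHom k), heq, Polynomial.natDegree_X_pow]

/-- `T·ω_n^+ ∣ ω_n` (`ω_n = T ω_n^+ ω_n^-`). [cite: Pollack2003, §6.5 (display before Prop. 6.18)] -/
theorem X_mul_cyclotomicOmegaPlus_dvd (n : ℕ) : X * cyclotomicOmegaPlus p n ∣ cyclotomicOmega p n :=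
  ⟨cyclotomicOmegaMinus p n, (X_mul_cyclotomicOmegaPlus_mul_cyclotomicOmegaMinus p n).symm⟩

/-- `T·ω_n^- ∣ ω_n`. [cite: Pollack2003, §6.5 (display before Prop. 6.18)] -/
theorem X_mul_cyclotomicOmegaMinus_dvd (n : ℕ) : X * cyclotomicOmegaMinus p n ∣ cyclotomicOmega p n :=
  ⟨cyclotomicOmegaPlus p n, by rw [← X_mul_cyclotomicOmegaPlus_mul_cyclotomicOmegaMinus p n]; ring⟩

/-- `deg ω_{2m}^+ ≥ m`. [cite: Pollack2003, §6.5 (display before Prop. 6.18)] -/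
theorem le_natDegree_cyclotomicOmegaPlus (m : ℕ) : m ≤ (cyclotomicOmegaPlus p (2 * m)).natDegree := by
  induction m with
  | zero => simp
  | succ m ih =>
    rw [show 2 * (m + 1) = 2 * m + 2 by ring, cyclotomicOmegaPlus_two_mul_add_two,
      (monic_cyclotomicOmegaPlus p (2 * m)).natDegree_mul (monic_cyclotomic_comp_X_add_one _)]
    have h1 : 1 ≤ ((cyclotomic (p ^ (2 * m + 2)) ℤ).comp (X + 1)).natDegree := by
      rw [Polynomial.natDegree_comp, natDegree_cyclotomic, show (X + 1 : ℤ[X]) = X + C 1 by rw [C_1],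
        natDegree_X_add_C, mul_one]
      exact Nat.totient_pos.mpr (pow_pos hp.out.pos _)
    omega

/-- `deg ω_{2m+1}^- ≥ m + 1`. [cite: Pollack2003, §6.5 (display before Prop. 6.18)] -/
theorem le_natDegree_cyclotomicOmegaMinus (m : ℕ) : m + 1 ≤ (cyclotomicOmegaMinus p (2 * m + 1)).natDegree := by
  induction m with
  | zero =>
    rw [cyclotomicOmegaMinus_two_mul_add_one, cyclotomicOmegaMinus_two_mul_add_two, Nat.mul_zero,
      cyclotomicOmegaMinus_zero, one_mul, Polynomial.natDegree_comp, natDegree_cyclotomic,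
      show (X + 1 : ℤ[X]) = X + C 1 by rw [C_1], natDegree_X_add_C, mul_one, Nat.zero_add]
    exact Nat.totient_pos.mpr (pow_pos hp.out.pos _)
  | succ m ih =>
    rw [show 2 * (m + 1) + 1 = 2 * (m + 1) + 1 from rfl, cyclotomicOmegaMinus_two_mul_add_one,
      show 2 * (m + 1) + 2 = 2 * (m + 1) + 2 from rfl, cyclotomicOmegaMinus_two_mul_add_two,
      show 2 * (m + 1) = 2 * m + 2 by ring, ← cyclotomicOmegaMinus_two_mul_add_one,
      (monic_cyclotomicOmegaMinus p (2 * m + 1)).natDegree_mul (monic_cyclotomic_comp_X_add_one _)]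
    have h1 : 1 ≤ ((cyclotomic (p ^ (2 * m + 2 + 1)) ℤ).comp (X + 1)).natDegree := by
      rw [Polynomial.natDegree_comp, natDegree_cyclotomic, show (X + 1 : ℤ[X]) = X + C 1 by rw [C_1],
        natDegree_X_add_C, mul_one]
      exact Nat.totient_pos.mpr (pow_pos hp.out.pos _)
    omega

/-- Over a local ring `O` whose residue field `k` has characteristic `p`: a monic divisor `D` of `ω_n` becomes, as a power
series over `O`, congruent to `T^{deg D}` modulo `𝔪`. [folklore] -/
theorem map_residue_coe_eq_X_pow {O : Type*} [CommRing O] [IsLocalRing O] [CharP (IsLocalRing.ResidueField O) p]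
    {D : ℤ[X]} (hD : D.Monic) {n : ℕ} (hdvd : D ∣ cyclotomicOmega p n) :
    PowerSeries.map (IsLocalRing.residue O) ((D.map (Int.castRingHom O) : O[X]) : O⟦X⟧) =
      PowerSeries.X ^ D.natDegree := by
  rw [← Polynomial.polynomial_map_coe, Polynomial.map_map,
    RingHom.ext_int ((IsLocalRing.residue O).comp (Int.castRingHom O)) (Int.castRingHom _),
    map_eq_X_pow_natDegree_of_dvd_cyclotomicOmega p (IsLocalRing.ResidueField O) hD hdvd, Polynomial.coe_pow,
    Polynomial.coe_X]

end Cyclotomic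

/-! ## §3. Pollack pairs over `𝒪 = padicCoeffIntegers S`: integral differences and uniqueness -/

section PollackPair

open Literature.NumberTheory.EllipticCurves Literature.NumberTheory.EllipticCurves.ModularForms CongruenceSubgroup
  Literature.NumberTheory.Automorphic

variable {p : ℕ} [hp : Fact p.Prime] {S : Set (PadicAlgCl p)}

/-- `𝒪⟦T⟧ → ℚ̄_p⟦T⟧` on (the power series of) an integer polynomial. [folklore] -/
theorem iwasawaOToPowerSeries_coe_map (P : ℤ[X]) :
    iwasawaOToPowerSeries S ((P.map (Int.castRingHom (padicCoeffIntegers S)) : (padicCoeffIntegers S)[X]) :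
        IwasawaAlgebraO S) =
      ((P.map (Int.castRingHom (PadicAlgCl p)) : (PadicAlgCl p)[X]) : PowerSeries (PadicAlgCl p)) := by
  ext k
  rw [coeff_iwasawaOToPowerSeries, Polynomial.coeff_coe, Polynomial.coeff_coe, Polynomial.coeff_map,
    Polynomial.coeff_map, eq_intCast, eq_intCast]
  simp

/-- `𝒪⟦T⟧ → ℚ̄_p⟦T⟧` on a constant `p^N`. [folklore] -/
theorem iwasawaOToPowerSeries_C_natCast_pow (N : ℕ) :
    iwasawaOToPowerSeries S (PowerSeries.C (((p : ℕ) : padicCoeffIntegers S) ^ N)) =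
      PowerSeries.C ((p : PadicAlgCl p) ^ N) := by
  rw [iwasawaOToPowerSeries, PowerSeries.map_C]
  simp

/-- **Step 1 (integral difference).** Two solutions `L₁, L₂ ∈ 𝒪⟦T⟧` of the same congruence `θ ≡ P·L (mod ω_n)` in
`𝒪⟦T⟧ ⊗ ℚ` (`IsCongrModOmegaO`) satisfy `p^N · P · (L₂ − L₁) ∈ ω_n 𝒪⟦T⟧` for some `N` — subtract the two witnesses and use
the injectivity of `𝒪⟦T⟧ → ℚ̄_p⟦T⟧`. [cite: Pollack2003, Prop. 6.18 (shape of the congruences)] -/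
theorem exists_C_pow_mul_sub_eq_of_isCongrModOmegaO {n : ℕ} {θ : (PadicAlgCl p)[X]} {P : ℤ[X]}
    {L₁ L₂ : IwasawaAlgebraO S}
    (h₁ : IsCongrModOmegaO S n θ
      (((P.map (Int.castRingHom (PadicAlgCl p)) : (PadicAlgCl p)[X]) : PowerSeries (PadicAlgCl p)) *
        iwasawaOToPowerSeries S L₁))
    (h₂ : IsCongrModOmegaO S n θ
      (((P.map (Int.castRingHom (PadicAlgCl p)) : (PadicAlgCl p)[X]) : PowerSeries (PadicAlgCl p)) *
        iwasawaOToPowerSeries S L₂)) :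
    ∃ (N : ℕ) (r : IwasawaAlgebraO S),
      PowerSeries.C (((p : ℕ) : padicCoeffIntegers S) ^ N) *
          (((P.map (Int.castRingHom (padicCoeffIntegers S)) : (padicCoeffIntegers S)[X]) : IwasawaAlgebraO S) *
            (L₂ - L₁)) =
        (((cyclotomicOmega p n).map (Int.castRingHom (padicCoeffIntegers S)) : (padicCoeffIntegers S)[X]) :
            IwasawaAlgebraO S) * r := by
  obtain ⟨m₁, q₁, e₁⟩ := h₁
  obtain ⟨m₂, q₂, e₂⟩ := h₂
  refine ⟨m₁ + m₂, PowerSeries.C (((p : ℕ) : padicCoeffIntegers S) ^ m₂) * q₁ -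
    PowerSeries.C (((p : ℕ) : padicCoeffIntegers S) ^ m₁) * q₂, iwasawaOToPowerSeries_injective S ?_⟩
  rw [map_mul, map_mul, map_sub, iwasawaOToPowerSeries_C_natCast_pow, iwasawaOToPowerSeries_coe_map, map_mul,
    iwasawaOToPowerSeries_coe_map, map_sub, map_mul, map_mul, iwasawaOToPowerSeries_C_natCast_pow,
    iwasawaOToPowerSeries_C_natCast_pow, pow_add, map_mul]
  linear_combination (PowerSeries.C ((p : PadicAlgCl p) ^ m₂)) * e₁ - (PowerSeries.C ((p : PadicAlgCl p) ^ m₁)) * e₂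

/-- `p` is not a unit of `𝒪 = padicCoeffIntegers S` (`‖p‖ = p⁻¹ < 1`, units of `𝒪` have norm `1`). [folklore] -/
theorem not_isUnit_natCast_padicCoeffIntegers : ¬ IsUnit (((p : ℕ) : padicCoeffIntegers S)) := by
  rintro ⟨u, hu⟩
  have h1 : ‖((u : padicCoeffIntegers S) : PadicAlgCl p)‖ * ‖((↑u⁻¹ : padicCoeffIntegers S) : PadicAlgCl p)‖ = 1 := by
    rw [← norm_mul, ← Subring.coe_mul, Units.mul_inv, Subring.coe_one, norm_one]
  have h2 : ‖((u : padicCoeffIntegers S) : PadicAlgCl p)‖ < 1 := by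
    rw [hu, Subring.coe_natCast, ← map_natCast (algebraMap ℚ_[p] (PadicAlgCl p)) p]
    exact (PadicAlgCl.norm_extends p (p : ℚ_[p])).trans_lt (Padic.norm_p_lt_one)
  have h3 : ‖((↑u⁻¹ : padicCoeffIntegers S) : PadicAlgCl p)‖ ≤ 1 := (↑u⁻¹ : padicCoeffIntegers S).2.2
  nlinarith [norm_nonneg ((↑u⁻¹ : padicCoeffIntegers S) : PadicAlgCl p), norm_nonneg ((u : padicCoeffIntegers S) : PadicAlgCl p)]

/-- `(p : 𝒪)^N ≠ 0`. [folklore] -/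
theorem natCast_pow_ne_zero_padicCoeffIntegers (N : ℕ) : (((p : ℕ) : padicCoeffIntegers S) ^ N) ≠ 0 := by
  apply pow_ne_zero
  intro h0
  have h1 : ((((p : ℕ) : padicCoeffIntegers S)) : PadicAlgCl p) = 0 := by rw [h0, Subring.coe_zero]
  rw [Subring.coe_natCast] at h1
  exact (Nat.cast_ne_zero.mpr hp.out.ne_zero) h1

/-- `𝒪 = padicCoeffIntegers S` is a discrete valuation ring (for `ℚ_p(S)/ℚ_p` finite). [cite: NeukirchANT1999, Ch. II (4.8)] -/
theorem isDiscreteValuationRing_padicCoeffIntegers [FiniteDimensional ℚ_[p] (padicCoeffField S)] :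
    IsDiscreteValuationRing (padicCoeffIntegers S) := by
  rw [padicCoeffIntegers_eq_unitBall]; exact LambdaLowerBoundO.isDiscreteValuationRing_unitBall p _

/-- The residue field of `𝒪` has characteristic `p` (`p ∈ 𝔪`). [folklore] -/
theorem charP_residueField_padicCoeffIntegers [IsLocalRing (padicCoeffIntegers S)] :
    CharP (IsLocalRing.ResidueField (padicCoeffIntegers S)) p := by
  rw [CharP.charP_iff_prime_eq_zero hp.out, ← map_natCast (IsLocalRing.residue (padicCoeffIntegers S)) p,
    IsLocalRing.residue_eq_zero_iff, IsLocalRing.mem_maximalIdeal, mem_nonunits_iff]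
  exact not_isUnit_natCast_padicCoeffIntegers

variable (S) in
/-- **Steps 2–3 (one sign).** If `L₁, L₂` both solve `θ ≡ c·ω'·L (mod ω_n)` with `c = ±1`, `ω_n = D·ω'`, `D` and `ω'` monic,
then `D ∣ L₂ − L₁` in `𝒪⟦T⟧` (cancel `ω'` in the domain `𝒪⟦T⟧`, then the constant `p^N` against `D`, whose reduction modulo `𝔪`
is `T^{deg D} ≠ 0`). [cite: Pollack2003, Prop. 6.18 (shape of the congruences)] -/
theorem dvd_sub_of_isCongrModOmegaO [FiniteDimensional ℚ_[p] (padicCoeffField S)] {n : ℕ} {θ : (PadicAlgCl p)[X]}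
    {c D ω' : ℤ[X]} (hc : c = 1 ∨ c = -1) (hD : D.Monic) (hω' : ω'.Monic) (hfac : cyclotomicOmega p n = D * ω')
    {L₁ L₂ : IwasawaAlgebraO S}
    (h₁ : IsCongrModOmegaO S n θ
      ((((c * ω').map (Int.castRingHom (PadicAlgCl p)) : (PadicAlgCl p)[X]) : PowerSeries (PadicAlgCl p)) *
        iwasawaOToPowerSeries S L₁))
    (h₂ : IsCongrModOmegaO S n θ
      ((((c * ω').map (Int.castRingHom (PadicAlgCl p)) : (PadicAlgCl p)[X]) : PowerSeries (PadicAlgCl p)) *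
        iwasawaOToPowerSeries S L₂)) :
    ((D.map (Int.castRingHom (padicCoeffIntegers S)) : (padicCoeffIntegers S)[X]) : IwasawaAlgebraO S) ∣ L₂ - L₁ := by
  obtain ⟨N, r, hr⟩ := exists_C_pow_mul_sub_eq_of_isCongrModOmegaO h₁ h₂
  haveI : IsDiscreteValuationRing (padicCoeffIntegers S) := isDiscreteValuationRing_padicCoeffIntegers
  haveI : CharP (IsLocalRing.ResidueField (padicCoeffIntegers S)) p := charP_residueField_padicCoeffIntegers
  set Dₒ : IwasawaAlgebraO S := (↑(D.map (Int.castRingHom (padicCoeffIntegers S))) : IwasawaAlgebraO S) with hDₒ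
  set ωₒ : IwasawaAlgebraO S := (↑(ω'.map (Int.castRingHom (padicCoeffIntegers S))) : IwasawaAlgebraO S) with hωₒ
  set cₒ : IwasawaAlgebraO S := (↑(c.map (Int.castRingHom (padicCoeffIntegers S))) : IwasawaAlgebraO S) with hcₒ
  set π : IwasawaAlgebraO S := PowerSeries.C (((p : ℕ) : padicCoeffIntegers S) ^ N) with hπ
  have hcu : cₒ * cₒ = 1 := by
    rcases hc with rfl | rfl <;> simp [hcₒ]
  have hωne : ωₒ ≠ 0 := by
    rw [hωₒ, Ne, Polynomial.coe_eq_zero_iff]; exact (hω'.map _).ne_zero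
  have e1 : (((c * ω').map (Int.castRingHom (padicCoeffIntegers S)) : (padicCoeffIntegers S)[X]) : IwasawaAlgebraO S) =
      cₒ * ωₒ := by
    rw [Polynomial.map_mul, Polynomial.coe_mul]
  have e2 : (((cyclotomicOmega p n).map (Int.castRingHom (padicCoeffIntegers S)) : (padicCoeffIntegers S)[X]) :
      IwasawaAlgebraO S) = Dₒ * ωₒ := by
    rw [hfac, Polynomial.map_mul, Polynomial.coe_mul]
  rw [e1, e2] at hr
  have h1 : ωₒ * (π * (cₒ * (L₂ - L₁))) = ωₒ * (Dₒ * r) := by linear_combination hr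
  have h2 := mul_left_cancel₀ hωne h1
  have h3 : π * (L₂ - L₁) = Dₒ * (cₒ * r) := by
    linear_combination cₒ * h2 - (π * (L₂ - L₁)) * hcu
  have hDred : PowerSeries.map (IsLocalRing.residue (padicCoeffIntegers S)) Dₒ ≠ 0 := by
    rw [hDₒ, map_residue_coe_eq_X_pow p hD ⟨ω', hfac⟩]; exact pow_ne_zero _ PowerSeries.X_ne_zero
  exact exists_eq_mul_of_C_mul_eq_mul_of_ne_zero (natCast_pow_ne_zero_padicCoeffIntegers N) hDred h3

variable {M : ℕ} {g : CuspForm (Gamma0 M) 2} {ι : coeffField g →+* PadicAlgCl p} {Ω : ℂ}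

/-- **Uniqueness of the `𝒪`-Pollack pair** (Pollack's labelling): two Pollack pairs `(L⁺, L⁻)`, `(L⁺', L⁻')` for the newform `g`
along `ι : K_g → ℚ̄_p` relative to `Ω` (`IsPollackPairK g ι Ω`) are EQUAL. The odd-level congruences determine `L⁺ mod T ω_n^-`, the
even-level ones `L⁻ mod T ω_n^+`, integrally in `𝒪⟦T⟧`, and `⋂ₙ (T ω_n^∓) = 0` (unbounded degrees). Hence the crux's exponent
`d = λ(L⁻_g)` is an invariant of `(g, ι, Ω)`. (`𝒪⟦T⟧`-twin of `Sprung2017.IsSprungPair.unique`; uniqueness clause of Pollack 2003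
Thm. 5.1 / Sprung 2017 Thm. 1.12 over `Λ = 𝒪⟦T⟧`.) [cite: Pollack2003, Thm. 5.1 and Prop. 6.18] [cite: Sprung2017, Thm. 1.12] -/
theorem isPollackPairK_unique [FiniteDimensional ℚ_[p] (padicCoeffField (Set.range ι))]
    {Lp Lm Lp' Lm' : IwasawaAlgebraO (Set.range ι)}
    (h : IsPollackPairK g ι Ω Lp Lm) (h' : IsPollackPairK g ι Ω Lp' Lm') : Lp = Lp' ∧ Lm = Lm' := by
  haveI : IsDiscreteValuationRing (padicCoeffIntegers (Set.range ι)) := isDiscreteValuationRing_padicCoeffIntegers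
  haveI : CharP (IsLocalRing.ResidueField (padicCoeffIntegers (Set.range ι))) p := charP_residueField_padicCoeffIntegers
  have hsign : ∀ n : ℕ, ((-1 : ℤ[X]) ^ (n / 2 + 1)) = 1 ∨ ((-1 : ℤ[X]) ^ (n / 2 + 1)) = -1 :=
    fun n ↦ neg_one_pow_eq_or ℤ[X] (n / 2 + 1)
  obtain ⟨-, -, hodd, heven⟩ := h
  obtain ⟨-, -, hodd', heven'⟩ := h'
  constructor
  · -- `L⁺`: odd levels `n = 2m+1`, `D_m = T ω_{2m+1}^-`
    rw [← sub_eq_zero]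
    refine eq_zero_of_forall_dvd_of_map_eq_X_pow (O := padicCoeffIntegers (Set.range ι))
      (fun m : ℕ ↦ (((X * cyclotomicOmegaMinus p (2 * m + 1)).map (Int.castRingHom (padicCoeffIntegers (Set.range ι))) :
        (padicCoeffIntegers (Set.range ι))[X]) : IwasawaAlgebraO (Set.range ι)))
      (fun m ↦ (X * cyclotomicOmegaMinus p (2 * m + 1)).natDegree)
      (fun m ↦ map_residue_coe_eq_X_pow p (monic_X.mul (monic_cyclotomicOmegaMinus p _))
        (X_mul_cyclotomicOmegaMinus_dvd p _))
      (fun k ↦ ⟨k, ?_⟩) (fun m ↦ ?_)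
    · rw [monic_X.natDegree_mul (monic_cyclotomicOmegaMinus p _), natDegree_X]
      have := le_natDegree_cyclotomicOmegaMinus p k
      omega
    · exact dvd_sub_of_isCongrModOmegaO (Set.range ι) (hsign (2 * m + 1)) (monic_X.mul (monic_cyclotomicOmegaMinus p _))
        (monic_cyclotomicOmegaPlus p _)
        (by rw [← X_mul_cyclotomicOmegaPlus_mul_cyclotomicOmegaMinus]; ring)
        (hodd' (2 * m + 1) ⟨m, rfl⟩) (hodd (2 * m + 1) ⟨m, rfl⟩)
  · -- `L⁻`: even levels `n = 2m`, `D_m = T ω_{2m}^+`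
    rw [← sub_eq_zero]
    refine eq_zero_of_forall_dvd_of_map_eq_X_pow (O := padicCoeffIntegers (Set.range ι))
      (fun m : ℕ ↦ (((X * cyclotomicOmegaPlus p (2 * m)).map (Int.castRingHom (padicCoeffIntegers (Set.range ι))) :
        (padicCoeffIntegers (Set.range ι))[X]) : IwasawaAlgebraO (Set.range ι)))
      (fun m ↦ (X * cyclotomicOmegaPlus p (2 * m)).natDegree)
      (fun m ↦ map_residue_coe_eq_X_pow p (monic_X.mul (monic_cyclotomicOmegaPlus p _))
        (X_mul_cyclotomicOmegaPlus_dvd p _))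
      (fun k ↦ ⟨k, ?_⟩) (fun m ↦ ?_)
    · rw [monic_X.natDegree_mul (monic_cyclotomicOmegaPlus p _), natDegree_X]
      have := le_natDegree_cyclotomicOmegaPlus p k
      omega
    · exact dvd_sub_of_isCongrModOmegaO (Set.range ι) (hsign (2 * m)) (monic_X.mul (monic_cyclotomicOmegaPlus p _))
        (monic_cyclotomicOmegaMinus p _) (X_mul_cyclotomicOmegaPlus_mul_cyclotomicOmegaMinus p (2 * m)).symm
        (heven' (2 * m) ⟨m, two_mul m⟩) (heven (2 * m) ⟨m, two_mul m⟩)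

end PollackPair

end Summit.BirchSwinnertonDyer.BirchSwinnertonDyer.Theorems.PollackPairK

end
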